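import Mathlib.Algebra.Order.Archimedean.Real.Hom
import Mathlib.Algebra.Order.Ring.Cone
import Mathlib.Analysis.Complex.Basic
import Mathlib.FieldTheory.IsAlgClosed.Basic
import Mathlib.RingTheory.Algebraic.Integral
import Mathlib.Algebra.Algebra.Hom.Rat
import Mathlib.Data.Rat.Cast.Order
import Mathlib.Algebra.Order.Floor.Semiring
import HarnessLib

/-!
# Artin–Schreier: involutions of an algebraically closed field are complex conjugations

Let `L` be an algebraically closed field of characteristic zero that is algebraic over `ℚ`
(e.g. `L = K̄` for a number field `K`) and let `σ` be a ring endomorphism of `L` with `σ ∘ σ = id`,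
`σ ≠ id`.  Then there is a ring embedding `ι : L →+* ℂ` with `ι ∘ σ = conj ∘ ι`
(`GaloisInvolution.exists_ringHom_complex_of_involution`): `σ` *is* complex conjugation for a
suitable embedding into `ℂ`.  This is the involution form of the theorem of E. Artin and
O. Schreier (1927) — the fixed field of a nontrivial involution of an algebraically closed field
of characteristic `0` is real closed — in the only case needed for absolute Galois groups of number
fields (consumed by `AbsGaloisGroupInvolutions.lean`).

Proof (elementary; no real-closure theory is used; all steps are in this file).
* (A) For any `y ≠ 0` with `σ y = -y`, every `z` is uniquely `a + b·y` with `a, b` fixed.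
* (B) `σ i = -i` for `i² = -1`: with `y = x - σ x ≠ 0` and `β² = y`, `β = u + v y` forces
  `u² + v² y² = 0`, `2uv = 1`, so `(yv/u)² = -1` is anti-fixed and `i = ± yv/u`.
* (C) the fixed field `R` is euclidean: every `r ∈ R` is `u²` or `-v²` (square roots in
  `L = R ⊕ R i`), sums of two squares of `R` are squares (`(p+qi)² = a+bi ⇒ a²+b² = (p²+q²)²`),
  and `-1` is not a square in `R`.
* (D) the squares of `R` form a maximal ring cone, so `R` is a linearly ordered field (Mathlib's
  `RingCone` API); it is archimedean because every element satisfies a monic equation over `ℚ`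
  (Cauchy's root bound), hence embeds in `ℝ` (`Real.nonemptyOrderRingHom`).
* (E) `ι(a + b i) := φ₀ a + φ₀ b · I` is a ring homomorphism `L →+* ℂ` with `ι ∘ σ = conj ∘ ι`.

Sources: E. Artin, O. Schreier, *Eine Kennzeichnung der reell abgeschlossenen Körper*, Abh. Math.
Sem. Hamburg 5 (1927) 225–231 (Satz 3: `R(i)` algebraically closed with `i ∉ R` forces `R` real
closed; Satz 4: finite-codimension subfields of algebraically closed fields).  Not here: the
general theorem for arbitrary characteristic-zero fields (whose fixed fields need not embed in
`ℝ`), uniqueness of real closures.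
-/

noncomputable section

open Polynomial

namespace Literature.NumberTheory.GaloisRepresentations

namespace GaloisInvolution

/-! ### (A)–(C): algebra of an involution of an algebraically closed field -/

section FieldInvolution

variable {L : Type*} [Field L] [CharZero L] (σ : L →+* L)

/-- (A) Decomposition along an anti-fixed element: if `σ y = -y`, `y ≠ 0`, every `z` is
`a + b y` with `σ a = a`, `σ b = b`. [folklore] -/
private theorem exists_decomp (hσ : ∀ x, σ (σ x) = x) {y : L} (hy : σ y = -y) (hy0 : y ≠ 0)
    (z : L) :
    ∃ a b : L, σ a = a ∧ σ b = b ∧ z = a + b * y := by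
  refine ⟨(z + σ z) / 2, (z - σ z) / (2 * y), ?_, ?_, ?_⟩
  · rw [map_div₀, map_add, hσ, map_ofNat, add_comm]
  · rw [map_div₀, map_sub, hσ, map_mul, map_ofNat, hy, mul_neg, div_neg, ← neg_div, neg_sub]
  · field_simp
    ring

/-- (A') Uniqueness of the decomposition along an anti-fixed element. [folklore] -/
private theorem decomp_unique {y : L} (hy : σ y = -y) (hy0 : y ≠ 0) {a b a' b' : L}
    (ha : σ a = a) (hb : σ b = b) (ha' : σ a' = a') (hb' : σ b' = b')
    (h : a + b * y = a' + b' * y) : a = a' ∧ b = b' := by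
  have h' := congr_arg σ h
  simp only [map_add, map_mul, ha, hb, ha', hb', hy] at h'
  have hb2 : b = b' := by
    have h0 : (b - b') * (2 * y) = 0 := by linear_combination h - h'
    rcases mul_eq_zero.mp h0 with h1 | h1
    · exact sub_eq_zero.mp h1
    · exact absurd h1 (mul_ne_zero two_ne_zero hy0)
  refine ⟨?_, hb2⟩
  rw [hb2] at h
  linear_combination h

/-- (B) An involution `σ ≠ 1` of a field of characteristic zero in which every element is a
square sends a square root `i` of `-1` to `-i` (so `i` is not fixed).
[cite: ArtinSchreier1927, Satz 3] -/
theorem map_sqrt_neg_one (hσ : ∀ x, σ (σ x) = x) (hsq : ∀ z : L, ∃ t, t * t = z)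
    (hne : ∃ x, σ x ≠ x) {i : L} (hi : i * i = -1) : σ i = -i := by
  obtain ⟨x, hx⟩ := hne
  obtain ⟨β, hβ⟩ := hsq (x - σ x)
  have hy : σ (x - σ x) = -(x - σ x) := by rw [map_sub, hσ, neg_sub]
  have hy0 : x - σ x ≠ 0 := fun h => hx (sub_eq_zero.mp h).symm
  obtain ⟨u, v, hu, hv, hβuv⟩ := exists_decomp σ hσ hy hy0 β
  have hyy : σ ((x - σ x) * (x - σ x)) = (x - σ x) * (x - σ x) := by
    rw [map_mul, hy, neg_mul_neg]
  obtain ⟨h1, h2⟩ := decomp_unique σ hy hy0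
    (a := u * u + v * v * ((x - σ x) * (x - σ x))) (b := 2 * u * v) (a' := 0) (b' := 1)
    (by rw [map_add, map_mul, map_mul, map_mul, hu, hv, hyy])
    (by rw [map_mul, map_mul, map_ofNat, hu, hv]) (map_zero σ) (map_one σ)
    (by rw [hβuv] at hβ; linear_combination hβ)
  have hu0 : u ≠ 0 := by
    rintro rfl
    simp at h2
  have hjj : (x - σ x) * v / u * ((x - σ x) * v / u) = -1 := by
    rw [div_mul_div_comm, div_eq_iff (mul_ne_zero hu0 hu0)]
    linear_combination h1
  have hσj : σ ((x - σ x) * v / u) = -((x - σ x) * v / u) := by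
    rw [map_div₀, map_mul, hy, hv, hu, neg_mul, neg_div]
  have h0 : (i - (x - σ x) * v / u) * (i + (x - σ x) * v / u) = 0 := by
    linear_combination hi - hjj
  rcases mul_eq_zero.mp h0 with h | h
  · rw [sub_eq_zero.mp h, hσj]
  · rw [eq_neg_of_add_eq_zero_left h, map_neg, hσj, neg_neg]

variable {σ} {i : L}

/-- (C1) In the situation of (B), every `σ`-fixed element is a `σ`-fixed square or minus a
`σ`-fixed square. [cite: ArtinSchreier1927, Satz 3] -/
theorem fixed_eq_sq_or_eq_neg_sq (hσ : ∀ x, σ (σ x) = x) (hsq : ∀ z : L, ∃ t, t * t = z)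
    (hi : i * i = -1) (hσi : σ i = -i) {r : L} (hr : σ r = r) :
    (∃ u, σ u = u ∧ r = u * u) ∨ (∃ v, σ v = v ∧ r = -(v * v)) := by
  have hi0 : i ≠ 0 := by
    rintro rfl
    rw [zero_mul] at hi
    exact one_ne_zero (by linear_combination hi)
  obtain ⟨β, hβ⟩ := hsq r
  obtain ⟨u, v, hu, hv, hβuv⟩ := exists_decomp σ hσ hσi hi0 β
  obtain ⟨h1, h2⟩ := decomp_unique σ hσi hi0 (a := u * u - v * v) (b := 2 * u * v)
    (a' := r) (b' := 0) (by rw [map_sub, map_mul, map_mul, hu, hv])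
    (by rw [map_mul, map_mul, map_ofNat, hu, hv]) hr (map_zero σ)
    (by rw [hβuv] at hβ; linear_combination hβ - (v * v) * hi)
  rcases mul_eq_zero.mp h2 with h | h
  · rcases mul_eq_zero.mp h with h' | h'
    · exact absurd h' two_ne_zero
    · right
      refine ⟨v, hv, ?_⟩
      rw [h'] at h1
      linear_combination -h1
  · left
    refine ⟨u, hu, ?_⟩
    rw [h] at h1
    linear_combination -h1

/-- (C2) In the situation of (B), a sum of two `σ`-fixed squares is a `σ`-fixed square.
[cite: ArtinSchreier1927, Satz 3] -/
theorem fixed_sq_add_sq (hσ : ∀ x, σ (σ x) = x) (hsq : ∀ z : L, ∃ t, t * t = z)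
    (hi : i * i = -1) (hσi : σ i = -i) {a b : L} (ha : σ a = a) (hb : σ b = b) :
    ∃ s, σ s = s ∧ a * a + b * b = s * s := by
  have hi0 : i ≠ 0 := by
    rintro rfl
    rw [zero_mul] at hi
    exact one_ne_zero (by linear_combination hi)
  obtain ⟨β, hβ⟩ := hsq (a + b * i)
  obtain ⟨p, q, hp, hq, hβpq⟩ := exists_decomp σ hσ hσi hi0 β
  obtain ⟨h1, h2⟩ := decomp_unique σ hσi hi0 (a := p * p - q * q) (b := 2 * p * q)
    (a' := a) (b' := b) (by rw [map_sub, map_mul, map_mul, hp, hq])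
    (by rw [map_mul, map_mul, map_ofNat, hp, hq]) ha hb
    (by rw [hβpq] at hβ; linear_combination hβ - (q * q) * hi)
  refine ⟨p * p + q * q, by rw [map_add, map_mul, map_mul, hp, hq], ?_⟩
  rw [← h1, ← h2]
  ring

/-- (C3) In the situation of (B), `-1` is not the square of a `σ`-fixed element.
[cite: ArtinSchreier1927, Satz 3] -/
theorem fixed_mul_self_ne_neg_one (hi : i * i = -1) (hσi : σ i = -i) {r : L} (hr : σ r = r) :
    r * r ≠ -1 := by
  intro h
  have h0 : (r - i) * (r + i) = 0 := by linear_combination h - hi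
  have hr' : σ r = -r := by
    rcases mul_eq_zero.mp h0 with h' | h'
    · rw [sub_eq_zero.mp h', hσi]
    · rw [eq_neg_of_add_eq_zero_left h', map_neg, hσi, neg_neg]
  have h2r : (2 : L) * r = 0 := by linear_combination hr' - hr
  have hr0 : r = 0 := by
    rcases mul_eq_zero.mp h2r with h' | h'
    · exact absurd h' two_ne_zero
    · exact h'
  rw [hr0, mul_zero] at h
  exact one_ne_zero (by linear_combination h)

end FieldInvolution

/-! ### (D): a euclidean field integral over `ℚ` embeds in `ℝ` -/

section Euclidean

/-- A linearly ordered field each of whose elements satisfies a monic equation over `ℚ` is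
archimedean (Cauchy's bound `x ≤ 1 + ∑ |aᵢ|` for a root of a monic polynomial). [folklore] -/
private theorem archimedean_of_isIntegral_rat {R : Type*} [Field R] [LinearOrder R]
    [IsStrictOrderedRing R] (hint : ∀ r : R, IsIntegral ℚ r) : Archimedean R := by
  rw [archimedean_iff_nat_lt]
  intro x
  obtain ⟨p, hp, hpx⟩ := hint x
  rw [Polynomial.eval₂_eq_sum_range, Finset.sum_range_succ, hp.coeff_natDegree, map_one,
    one_mul] at hpx
  simp only [eq_ratCast] at hpx
  set n := p.natDegree with hn
  have hsum : x ^ n = -∑ i ∈ Finset.range n, (p.coeff i : R) * x ^ i := by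
    linear_combination hpx
  have hxle : x ≤ 1 + ∑ i ∈ Finset.range n, |(p.coeff i : R)| := by
    by_contra! hlt
    have hT0 : 0 ≤ ∑ i ∈ Finset.range n, |(p.coeff i : R)| :=
      Finset.sum_nonneg fun i _ => abs_nonneg _
    have hx1 : 1 ≤ x := by linarith
    have hx0 : 0 < x := by linarith
    have hn0 : n ≠ 0 := by
      intro hn0
      rw [hn0, Finset.sum_range_zero, neg_zero, pow_zero] at hsum
      exact one_ne_zero hsum
    have key : x ^ n ≤ (∑ i ∈ Finset.range n, |(p.coeff i : R)|) * x ^ (n - 1) := by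
      rw [hsum, Finset.sum_mul, ← Finset.sum_neg_distrib]
      refine Finset.sum_le_sum fun i hi => ?_
      have hi' : i ≤ n - 1 := by
        have := Finset.mem_range.mp hi
        omega
      calc -((p.coeff i : R) * x ^ i) = (-(p.coeff i : R)) * x ^ i := by ring
        _ ≤ |(p.coeff i : R)| * x ^ i :=
            mul_le_mul_of_nonneg_right (neg_le_abs _) (pow_nonneg hx0.le i)
        _ ≤ |(p.coeff i : R)| * x ^ (n - 1) :=
            mul_le_mul_of_nonneg_left (pow_le_pow_right₀ hx1 hi') (abs_nonneg _)
    have hxn : x ^ n = x * x ^ (n - 1) := by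
      rw [← pow_succ', Nat.sub_add_cancel (Nat.pos_of_ne_zero hn0)]
    rw [hxn] at key
    have hle : x ≤ ∑ i ∈ Finset.range n, |(p.coeff i : R)| :=
      le_of_mul_le_mul_right key (pow_pos hx0 _)
    linarith
  set S : ℚ := 1 + ∑ i ∈ Finset.range n, |p.coeff i| with hS
  have hcast : (1 : R) + ∑ i ∈ Finset.range n, |(p.coeff i : R)| = (S : R) := by
    rw [hS]
    push_cast
    rfl
  refine ⟨⌈S⌉₊ + 1, ?_⟩
  have hceil : (S : R) ≤ ((⌈S⌉₊ : ℕ) : R) := by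
    have h := Nat.le_ceil S
    have h' : (S : R) ≤ ((⌈S⌉₊ : ℚ) : R) := Rat.cast_le.mpr h
    simpa using h'
  calc x ≤ (S : R) := hcast ▸ hxle
    _ ≤ ((⌈S⌉₊ : ℕ) : R) := hceil
    _ < ((⌈S⌉₊ + 1 : ℕ) : R) := by exact_mod_cast Nat.lt_succ_self _

/-- (D) A field of characteristic zero in which every element is a square or minus a square,
sums of two squares are squares, `-1` is not a square, and every element is integral over `ℚ`,
admits a ring embedding into `ℝ` (order by the cone of squares; archimedean by
`archimedean_of_isIntegral_rat`; embed by `Real.nonemptyOrderRingHom`).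
[cite: ArtinSchreier1927, Satz 3] -/
theorem nonempty_ringHom_real {R : Type*} [Field R] [CharZero R]
    (hsq : ∀ r : R, IsSquare r ∨ IsSquare (-r)) (hsum : ∀ a b : R, IsSquare (a * a + b * b))
    (hneg : ¬ IsSquare (-1 : R)) (hint : ∀ r : R, IsIntegral ℚ r) : Nonempty (R →+* ℝ) := by
  classical
  let C : RingCone R :=
    { carrier := {r | IsSquare r}
      mul_mem' := fun {a b} ha hb => IsSquare.mul ha hb
      one_mem' := ⟨1, (mul_one 1).symm⟩
      add_mem' := by
        rintro a b ⟨s, rfl⟩ ⟨t, rfl⟩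
        exact hsum s t
      zero_mem' := ⟨0, (mul_zero 0).symm⟩
      eq_zero_of_mem_of_neg_mem' := by
        rintro a ⟨s, rfl⟩ ⟨t, ht⟩
        by_contra hs
        have hs' : s ≠ 0 := fun h => hs (by rw [h, mul_zero])
        exact hneg ⟨t / s, by field_simp; linear_combination ht⟩ }
  haveI : HasMemOrNegMem C := ⟨fun a => hsq a⟩
  letI : LinearOrder R := LinearOrder.mkOfAddGroupCone C
  haveI : IsOrderedRing R := IsOrderedRing.mkOfCone C
  haveI : IsStrictOrderedRing R := IsOrderedRing.toIsStrictOrderedRing R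
  haveI : Archimedean R := archimedean_of_isIntegral_rat hint
  exact ⟨(Classical.choice (Real.nonemptyOrderRingHom R)).toRingHom⟩

end Euclidean

/-! ### (E): extending a real embedding of the fixed field to `L = R ⊕ R·i → ℂ` -/

section Extension

variable {L : Type*} [Field L] [CharZero L] {σ : L →+* L} {i : L}

/-- (E) If `σ` is an involution of `L` with `σ i = -i`, `i² = -1`, and `φ₀` is a ring
homomorphism from the fixed field `R` of `σ` to `ℝ`, then `z = a + b i ↦ φ₀ a + φ₀ b · I` is a ring
homomorphism `ι : L →+* ℂ` with `ι ∘ σ = conj ∘ ι` extending `φ₀`. [folklore] -/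
private theorem exists_ringHom_complex (hσ : ∀ x, σ (σ x) = x) (hi : i * i = -1) (hσi : σ i = -i)
    (R : Subfield L) (hR : ∀ x, x ∈ R ↔ σ x = x) (φ₀ : R →+* ℝ) :
    ∃ ι : L →+* ℂ, (∀ z, ι (σ z) = starRingEnd ℂ (ι z)) ∧ ∀ r : R, ι r = φ₀ r := by
  -- real and imaginary parts with respect to `i`
  let re : L → R := fun z => ⟨(z + σ z) / 2, (hR _).2 (by
    rw [map_div₀, map_add, hσ, map_ofNat, add_comm])⟩
  let im : L → R := fun z => ⟨(σ z - z) * i / 2, (hR _).2 (by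
    rw [map_div₀, map_mul, map_sub, hσ, hσi, map_ofNat]; ring)⟩
  have cre : ∀ z, ((re z : R) : L) = (z + σ z) / 2 := fun z => rfl
  have cim : ∀ z, ((im z : R) : L) = (σ z - z) * i / 2 := fun z => rfl
  have re_one : re 1 = 1 := Subtype.ext (by rw [cre, map_one]; push_cast; ring)
  have im_one : im 1 = 0 := Subtype.ext (by rw [cim, map_one]; push_cast; ring)
  have re_zero : re 0 = 0 := Subtype.ext (by rw [cre, map_zero]; push_cast; ring)
  have im_zero : im 0 = 0 := Subtype.ext (by rw [cim, map_zero]; push_cast; ring)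
  have re_add : ∀ z w, re (z + w) = re z + re w := fun z w =>
    Subtype.ext (by push_cast [cre, map_add]; ring)
  have im_add : ∀ z w, im (z + w) = im z + im w := fun z w =>
    Subtype.ext (by push_cast [cim, map_add]; ring)
  have re_mul : ∀ z w, re (z * w) = re z * re w - im z * im w := fun z w =>
    Subtype.ext (by
      push_cast [cre, cim, map_mul]
      linear_combination ((σ z - z) * (σ w - w) / 4) * hi)
  have im_mul : ∀ z w, im (z * w) = re z * im w + im z * re w := fun z w =>
    Subtype.ext (by push_cast [cre, cim, map_mul]; ring)
  have re_σ : ∀ z, re (σ z) = re z := fun z => Subtype.ext (by rw [cre, cre, hσ, add_comm])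
  have im_σ : ∀ z, im (σ z) = -im z := fun z =>
    Subtype.ext (by push_cast [cim, hσ]; ring)
  have re_coe : ∀ r : R, re r = r := fun r =>
    Subtype.ext (by rw [cre, (hR _).1 r.2]; ring)
  have im_coe : ∀ r : R, im r = 0 := fun r =>
    Subtype.ext (by rw [cim, (hR _).1 r.2]; push_cast; ring)
  let ι : L →+* ℂ :=
    { toFun := fun z => (φ₀ (re z) : ℂ) + φ₀ (im z) * Complex.I
      map_one' := by simp only [re_one, im_one, map_one, map_zero]; push_cast; ring
      map_mul' := fun z w => by
        simp only [re_mul, im_mul, map_sub, map_add, map_mul]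
        push_cast
        linear_combination (-((φ₀ (im z) : ℂ) * (φ₀ (im w) : ℂ))) * Complex.I_mul_I
      map_zero' := by simp only [re_zero, im_zero, map_zero]; push_cast; ring
      map_add' := fun z w => by
        simp only [re_add, im_add, map_add]
        push_cast
        ring }
  refine ⟨ι, fun z => ?_, fun r => ?_⟩
  · show (φ₀ (re (σ z)) : ℂ) + φ₀ (im (σ z)) * Complex.I
      = starRingEnd ℂ ((φ₀ (re z) : ℂ) + φ₀ (im z) * Complex.I)
    rw [re_σ, im_σ, map_neg, map_add, map_mul, Complex.conj_ofReal, Complex.conj_ofReal,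
      Complex.conj_I]
    push_cast
    ring
  · show (φ₀ (re r) : ℂ) + φ₀ (im r) * Complex.I = φ₀ r
    rw [re_coe, im_coe, map_zero]
    push_cast
    ring

end Extension


/-! ### The packaged statement -/

/-- **Artin–Schreier (involution form, embedding version).**  Let `L` be an algebraically closed
field of characteristic zero, algebraic over `ℚ`, and `σ : L →+* L` with `σ ∘ σ = id`, `σ ≠ id`.
Then there is a ring embedding `ι : L →+* ℂ` with `ι (σ z) = conj (ι z)` for all `z`; in
particular the fixed field of `σ` embeds in `ℝ`. [cite: ArtinSchreier1927, Satz 3] -/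
theorem exists_ringHom_complex_of_involution {L : Type*} [Field L] [CharZero L] [IsAlgClosed L]
    [Algebra.IsAlgebraic ℚ L] (σ : L →+* L) (hσ : ∀ x, σ (σ x) = x) (hne : ∃ x, σ x ≠ x) :
    ∃ ι : L →+* ℂ, ∀ z, ι (σ z) = starRingEnd ℂ (ι z) := by
  have hsq : ∀ z : L, ∃ t, t * t = z := fun z => by
    obtain ⟨t, ht⟩ := IsAlgClosed.exists_eq_mul_self z
    exact ⟨t, ht.symm⟩
  obtain ⟨i, hi⟩ := hsq (-1)
  have hσi : σ i = -i := map_sqrt_neg_one σ hσ hsq hne hi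
  -- the fixed field of `σ` and its euclidean properties
  let R : Subfield L := σ.eqLocusField (RingHom.id _)
  have hR : ∀ x, x ∈ R ↔ σ x = x := fun x => Iff.rfl
  have e1 : ∀ r : R, IsSquare r ∨ IsSquare (-r) := fun r => by
    rcases fixed_eq_sq_or_eq_neg_sq hσ hsq hi hσi ((hR _).1 r.2) with ⟨u, hu, hru⟩ | ⟨v, hv, hrv⟩
    · exact Or.inl ⟨⟨u, (hR u).2 hu⟩, Subtype.ext hru⟩
    · exact Or.inr ⟨⟨v, (hR v).2 hv⟩, Subtype.ext (by push_cast; linear_combination -hrv)⟩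
  have e2 : ∀ a b : R, IsSquare (a * a + b * b) := fun a b => by
    obtain ⟨s, hs, habs⟩ := fixed_sq_add_sq hσ hsq hi hσi ((hR _).1 a.2) ((hR _).1 b.2)
    exact ⟨⟨s, (hR s).2 hs⟩, Subtype.ext habs⟩
  have e3 : ¬ IsSquare (-1 : R) := by
    rintro ⟨r, hr⟩
    exact fixed_mul_self_ne_neg_one hi hσi ((hR _).1 r.2) (by
      have := congr_arg (Subtype.val) hr
      push_cast at this
      exact this.symm)
  have e4 : ∀ r : R, IsIntegral ℚ r := fun r =>
    (isIntegral_algHom_iff R.subtype.toRatAlgHom Subtype.val_injective).mp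
      (Algebra.IsAlgebraic.isAlgebraic (r : L)).isIntegral
  obtain ⟨φ₀⟩ := nonempty_ringHom_real e1 e2 e3 e4
  obtain ⟨ι, hισ, -⟩ := exists_ringHom_complex hσ hi hσi R hR φ₀
  exact ⟨ι, hισ⟩

end GaloisInvolution

end Literature.NumberTheory.GaloisRepresentations
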